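import Summits.BirchSwinnertonDyer.BirchSwinnertonDyer.Theorems.SchneiderFreeAdditiveX3QuadraticGoodReductionDescent
import Summits.BirchSwinnertonDyer.BirchSwinnertonDyer.Theorems.SchneiderFreeAdditiveX3GordTwoBranchIMCCaseOne
import Summits.BirchSwinnertonDyer.Rank1Residual.Additive.DictionaryUniform
import HarnessLib

/-!
# Route `SchneiderFreeAdditiveX3` (K1 door): Keller–Yin's Case (I) on the additive reducible class IS the (G-ord, `e = 2`) census cell —
# at EVERY odd `p` (the converse of `hasGoodOrdinaryReductionOverQuadraticAt_of_subGordTwo`)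

Cell `bsd-schneider-ideate`, seat `bsd-schneider-door-c5` (prover, generation 30; assembly layer; `--supports` 19177, helper).
PARTITION: board row B6 ∩ X3 ∩ sst-twist, `r = 1` (7 101 pairs; (G-ord, `e = 2`) half 2 560, of which 2 411 at `p = 3`); types-the-object-of
nothing new; IDENTIFIES two binder ranges (the door items' `ClassX3 ∧ SubGordTwo` and Keller–Yin 2410.23241's `PotOrdSetting.caseOne ∧ red`
at an additive prime); closes none of B6's cells (BSD NOT advanced).  bears_on: K1-door (items 18971/18972 → 19177 r3 `GordTwoBranchIMC`).

WHAT.  Consequences of the descent theorem `QuadraticGoodReductionDescent.exists_goodOrd_pStar_twist_presentation_of_addv_of_caseOne`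
(p703967) read in the census vocabulary of `Rank1Residual.Additive`:
* `typeGOrd_of_addv_of_caseOne` — an additive `p` (odd) of Case (I) is (G)-ORDINARY (`Additive.TypeGOrd`, Delbourgo's hypothesis);
* `subGord_of_addv_of_caseOne` — hence in the census cell (G-ord) (`¬ PotMult ∧ f_p = 2 ∧ e ∣ p − 1`, `subGord_of_typeGOrd_of_addv`);
* `finrank_eq_two_of_addv_of_caseOne` — the Case (I) field of an additive `p` has degree EXACTLY `2` (degree `1` would make `E` good, by the
  dichotomy of p703152);
* `subGordTwo_of_addv_of_caseOne` — **`e = 2`** at every odd `p`: at `p = 3` by the tree's Kraus row for `I₀*`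
  (`subGordTwo_three_iff_typeG`), at `p ≥ 5` by Serre's formula over the Case (I) field itself (`hasGoodReductionAt_baseChange_quadratic_iff`);
* **`classX3_and_subGordTwo_iff_caseOne`** — for `W` globally minimal, `p` odd: `ClassX3 W p ∧ SubGordTwo W p ↔
  Red W p ∧ Addv W p ∧ HasGoodOrdinaryReductionOverQuadraticAt W p`.  So the door's items (binders `ClassX3`, `SubGordTwo`) and the
  `PotOrdSetting`-typed Keller–Yin facts (binders `caseOne`, `red`) range over THE SAME additive pairs.

HONEST FRAMING: theorems about elliptic curves over `ℚ` composed from tree theorems; no named fact, no definition, no `sorry`; nothing asserted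
about BSD; «closes rung: none».  References: Keller–Yin arXiv:2410.23241 §3.1 Case (I); D. Delbourgo, Compositio 113 (1998) §1.5 (G);
J.-P. Serre, Invent. Math. 15 (1972) §5.6; A. Kraus, Manuscripta Math. 69 (1990) (the `I₀*` row at `3`, tree `Additive.TypeGThree`).
-/

set_option autoImplicit false
set_option linter.dupNamespace false

noncomputable section

open scoped Classical NumberField

open Field NumberField IsDedekindDomain WeierstrassCurve IsDedekindDomain.HeightOneSpectrum Rat.HeightOneSpectrum
  Literature.NumberTheory.EllipticCurves Literature.NumberTheory.GaloisRepresentations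
  Literature.NumberTheory.EllipticCurves.Rank1Residual
  Summit.BirchSwinnertonDyer.Rank1Residual Summit.BirchSwinnertonDyer.Rank1Residual.Additive
  Summit.BirchSwinnertonDyer.BirchSwinnertonDyer.Theorems.SchneiderFree

namespace Summit.BirchSwinnertonDyer.BirchSwinnertonDyer.Theorems.SchneiderFreeAdditiveX3.QuadraticGoodReductionDescent

variable {p : ℕ} [hp : Fact p.Prime] (W : WeierstrassCurve ℚ) [W.IsElliptic] [W.IsGloballyMinimal]

omit [W.IsGloballyMinimal] in
/-- **An additive odd prime of Case (I) is (G)-ordinary** (`Additive.TypeGOrd`): `W = C • V^{(p*)}` with `V` good ordinary (p703967), read by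
the tree's `typeGOrd_of_goodOrd_quadraticTwist` on the model `V` of `W^{(p*)}`. [cite: Delbourgo1998, §1.5 hypothesis (G) (Compositio Math. 113)] -/
theorem typeGOrd_of_addv_of_caseOne (hp2 : p ≠ 2) (hadd : Addv W p) (hcase : W.HasGoodOrdinaryReductionOverQuadraticAt p) :
    TypeGOrd W p := by
  obtain ⟨V, _, _, C, hordV, hC⟩ := exists_goodOrd_pStar_twist_presentation_of_addv_of_caseOne hp2 W hadd hcase
  set ps : ℚ := (-1 : ℚ) ^ (p / 2) * p with hps
  have hps0 : ps ≠ 0 := pStar_ne_zero p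
  obtain ⟨D, hD⟩ := exists_quadraticTwist_quadraticTwist_eq_smul V hps0
  -- `W^{(p*)} = (C • V^{(p*)})^{(p*)} = C' • D • V`
  have hC₀ : ((⟨C.u, ps * C.r, 0, 0⟩ : VariableChange ℚ) * D)⁻¹ • W.quadraticTwist ps = V := by
    rw [← hC, WeierstrassCurve.quadraticTwist_smul, hD, ← mul_smul, ← mul_smul, mul_assoc, inv_mul_cancel, one_smul]
  exact typeGOrd_of_goodOrd_quadraticTwist W p hp2 V _ hC₀ hordV

/-- **Hence in the census cell (G-ord)**: `¬ PotMult ∧ f_p = 2 ∧ e ∣ p − 1` (`subGord_of_typeGOrd_of_addv`, every odd `p`).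
[cite: Delbourgo1998, §1.5 (G)] -/
theorem subGord_of_addv_of_caseOne (hp2 : p ≠ 2) (hadd : Addv W p) (hcase : W.HasGoodOrdinaryReductionOverQuadraticAt p) :
    SubGord W p :=
  subGord_of_typeGOrd_of_addv W p hp2 (typeGOrd_of_addv_of_caseOne W hp2 hadd hcase) hadd

omit [W.IsGloballyMinimal] in
/-- **The Case (I) field of an ADDITIVE prime has degree exactly `2`.**  In degree `1` every element of `Γ_ℚ` restricts from `Γ_F`, so the
dichotomy of p703152 (`hasGoodReductionAt_or_forall_inertia_smul_eq_neg`, whose second branch exhibits an element OUTSIDE `res(Γ_F)`) makes `E`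
good at `p`. [cite: SilvermanAEC2009, Thm. VII.7.1] -/
theorem finrank_eq_two_of_addv_of_hasGoodReductionAt_baseChange (hadd : Addv W p)
    {F : Type} [Field F] [NumberField F] (hF2 : Module.finrank ℚ F ≤ 2) {w : HeightOneSpectrum (𝓞 F)} (hw : (p : 𝓞 F) ∈ w.asIdeal)
    (hgoodF : (W.baseChange F).HasGoodReductionAt w) : Module.finrank ℚ F = 2 := by
  have hpP : p.Prime := hp.out
  set v : HeightOneSpectrum (𝓞 ℚ) := (primesEquiv (R := 𝓞 ℚ)).symm ⟨p, hpP⟩ with hvdef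
  have hpv : (p : 𝓞 ℚ) ∈ v.asIdeal := (natCast_mem_asIdeal_iff_eq_primesEquiv_symm v hpP).mpr hvdef
  have hwv : w.asIdeal.under (𝓞 ℚ) = v.asIdeal := under_eq_asIdeal_of_natCast_mem p w hw
  obtain ⟨𝔓F, h𝔓F⟩ := w.primesAbove_nonempty
  have hnotgood : ¬ W.HasGoodReductionAt v := fun h ↦ hadd.1 (W.hasGoodReductionAtPrime_of_hasGoodReductionAt v hpv h)
  have hpos : 0 < Module.finrank ℚ F := Module.finrank_pos
  rcases (show Module.finrank ℚ F = 1 ∨ Module.finrank ℚ F = 2 by omega) with h1 | h2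
  · exfalso
    have htop : ∀ τ : absoluteGaloisGroup ℚ, τ ∈ (absGaloisRestrict ℚ F).range := by
      intro τ
      rw [mem_range_absGaloisRestrict_iff_smul_absEmbedding]
      intro x
      have hx : x ∈ (⊥ : Subalgebra ℚ F) := by
        rw [Subalgebra.bot_eq_top_iff_finrank_eq_one.mpr h1]; exact Algebra.mem_top
      obtain ⟨q, rfl⟩ := Algebra.mem_bot.mp hx
      rw [AlgHom.commutes, absoluteGaloisGroup.smul_def, AlgEquiv.commutes]
    rcases hasGoodReductionAt_or_forall_inertia_smul_eq_neg W F hw hgoodF h𝔓F hpv hwv (fun a b ↦ by simp only [htop])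
      with hgood | ⟨⟨σ₀, -, hσ₀⟩, -⟩
    · exact hnotgood hgood
    · exact hσ₀ (htop σ₀)
  · exact h2

/-- **`e = 2` at every odd `p`: an additive prime of Case (I) lies on the (G-ord, `e = 2`) cell** (`SubGordTwo`).  At `p = 3` by the tree's
Kraus row for `I₀*` (`subGordTwo_three_iff_typeG`); at `p ≥ 5` by Serre's `12 / gcd(12, v_p Δ)` over the Case (I) field itself
(`hasGoodReductionAt_baseChange_quadratic_iff`: `E_F` good above `p` over a quadratic `F` iff `e = 2` and `p ∣ d_F`).
[cite: Serre1972, §5.6 (p ≥ 5)] [cite: Kraus1990, Thm. 1 (the I₀* row at p = 3; via Coppola 2020 Thm. 2.7)] -/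
theorem subGordTwo_of_addv_of_caseOne (hp2 : p ≠ 2) (hadd : Addv W p) (hcase : W.HasGoodOrdinaryReductionOverQuadraticAt p) :
    SubGordTwo W p := by
  have hpP : p.Prime := hp.out
  by_cases hp3 : p = 3
  · subst hp3
    exact (subGordTwo_three_iff_typeG W hadd).mpr (typeGOrd_of_addv_of_caseOne W hp2 hadd hcase).typeG
  · have hp5 : 5 ≤ p := by
      have h4 : p ≠ 4 := fun h ↦ by rw [h] at hpP; norm_num at hpP
      have h2 := hpP.two_le
      omega
    refine ⟨subGord_of_addv_of_caseOne W hp2 hadd hcase, ?_⟩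
    obtain ⟨F, _, _, w, hF2, hw, hgoodF, -⟩ := hcase
    have hj : 0 ≤ padicValRat p W.j := WeierstrassCurve.padicValRat_j_nonneg_of_hasGoodReductionAt_baseChange W p hpP w hw hgoodF
    have hF : Module.finrank ℚ F = 2 := finrank_eq_two_of_addv_of_hasGoodReductionAt_baseChange W hadd hF2 hw hgoodF
    exact ((hasGoodReductionAt_baseChange_quadratic_iff W p F w hp5 hadd hj hF hw).mp hgoodF).1

/-- **Keller–Yin's Case (I) on the additive reducible class IS the (G-ord, `e = 2`) cell** — for `W` globally minimal and `p` odd: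
`ClassX3 W p ∧ SubGordTwo W p ↔ Red W p ∧ Addv W p ∧ HasGoodOrdinaryReductionOverQuadraticAt W p` (forward: the tree's
`hasGoodOrdinaryReductionOverQuadraticAt_of_subGordTwo`; backward: this file).  So the door's items (binders `ClassX3`, `SubGordTwo`) and the
`PotOrdSetting`-typed facts of Keller–Yin 2410.23241 (binders `caseOne`, `red`) range over the same additive pairs.
[cite: KellerYin2024b, §3.1 Case (I) (arXiv:2410.23241 p. 13)] [cite: Delbourgo1998, §1.5 (G)] -/
theorem classX3_and_subGordTwo_iff_caseOne (hp2 : p ≠ 2) :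
    ClassX3 W p ∧ SubGordTwo W p ↔ Red W p ∧ Addv W p ∧ W.HasGoodOrdinaryReductionOverQuadraticAt p :=
  ⟨fun ⟨hX, hS⟩ ↦ ⟨hX.1, hX.2, hasGoodOrdinaryReductionOverQuadraticAt_of_subGordTwo hp2 W hX hS⟩,
    fun ⟨hred, hadd, hcase⟩ ↦ ⟨⟨hred, hadd⟩, subGordTwo_of_addv_of_caseOne W hp2 hadd hcase⟩⟩

end Summit.BirchSwinnertonDyer.BirchSwinnertonDyer.Theorems.SchneiderFreeAdditiveX3.QuadraticGoodReductionDescent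

end
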